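import Summits.BirchSwinnertonDyer.BirchSwinnertonDyer.Theorems.PrintCFramBottomClassIndexLawFiveLeHeegnerTwistShaSupply
import Summits.BirchSwinnertonDyer.Rank1Residual.X12.O11.RouteUTamagawaCM
import Literature.NumberTheory.EllipticCurves.IsogenyTamagawaParityProofs
import Literature.NumberTheory.EllipticCurves.SkinnerUrban2014.PAdicUnitPeriodRatioAnyPrimeProofs
import Literature.NumberTheory.EllipticCurves.AnomalousOfRationalTorsionProofs
import HarnessLib

/-!
# Crux `PrintCFram.BottomClassIndexLawFiveLe` (stmt-BirchSwinnertonDyer-20372), line `eisenstein-resource-bdp-line` (registry v19/v20):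
# **`#Ш[p^∞]` IS CONSTANT ON THE RATIONAL `p`-ISOGENY CLASS OF A RANK-ZERO CLASS MEMBER** — so the partner clause of the
# Ш-currency supply C_Ш is automatic, and Stub C follows from «ONE admissible Heegner twist with `L ≠ 0` and `Ш[p] = 0`»
# (cell `bsd-print-cfram`, width seat `bsd-line-cfram-p1-w5` g4; THEOREMS ONLY, `--supports` 20372; BSD is not proved by any of this)

HONEST FRAMING. THEOREMS ONLY (0 defs / 0 facts / 0 sorry); nothing about BSD is proved; no stub is closed; no summit statement is proved
by this seat. `…HeegnerTwistShaSupply` (p680012) proved Stub C ⟸ C_Ш with C_Ш carrying a PARTNER clause («`Ш(W₁)[p] = 0` for every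
globally minimal CM-ramified `p`-isogenous partner `W₁` of the minimal twist model `Wd`»), the shape the (β) rank-zero dictionary
produces. This file removes it: by CASSELS' isogeny invariance of the BSD quotient (`bsdRHS_eq_of_isIsogenous`, a conjunct of
`ToricPublishedInputs`), the CASSELS–TATE square (`isSquare_shaOrder_of_casselsTate`), and the NÉRON PERIOD RELATION along a
`p`-isogeny of globally minimal curves (`exists_int_mul_realPeriodRat_eq_of_isogeny`: `q·Ω(W) = a·Ω(W')` with `q ∣ p`, `ab = p`, from
the modular parametrisations of `ToricPublishedInputs`), two `p`-isogenous globally minimal curves of rank `0` with `p ∤ #tors` and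
`p ∤ ∏c_ℓ` on both sides have `ord_p #Ш(W) = ord_p #Ш(W')`: the two orders are squares, and they differ by the `p`-adic valuation of
`q/a ∈ {p⁻¹, 1, p}` — an even number in `{−1, 0, 1}` is `0`. On the CM-ramified class both side conditions hold (`W(ℚ_p)[p] = 0`,
so `p ∤ #tors`; CM curves have no split multiplicative place and `c_ℓ ≤ 4 < p` elsewhere, Kodaira–Néron).

* §1 **`padicValNat_shaOrder_eq_of_isogeny_prime_of_rank_zero`** — the generic Cassels/Cassels–Tate/Néron bookkeeping (any `W ∼ W'`).
* §2 `not_dvd_torsionOrder_of_cmRamified` (+ the tree's `RouteU.not_dvd_tamagawaProduct_of_hasCM`) — the two side conditions on the class;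
  **`sha_noPTorsion_partner_of_cmRamified`** — for a rank-zero class member `V` (`L(V,1) ≠ 0`) with `Ш(V)[p] = 0`, every globally minimal
  CM-ramified `p`-isogenous partner has `Ш[p] = 0` (mod `ToricPublishedInputs` for GZK / Cassels / modular parametrisations, and CT).
* §3 **`not_fieldFactor_le_of_twist_noPTorsion`** — `…HeegnerTwistShaSupply.not_fieldFactor_le_of_twist_noPTorsion_pair` WITHOUT the
  partner clause; **`stubC_of_heegnerTwistShaSupply_single`** — Stub C VERBATIM ⟸ **C_Ш¹** := «every rank-one class member has an
  admissible Heegner `K''` with `L(W^{(d)},1) ≠ 0` and a globally minimal twist model `Wd` with `Ш(Wd)[p] = 0`» (one curve, one condition).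

beyond-print theorem: NO (bookkeeping of landed/printed inputs). CONDITIONAL on the named facts (`ToricPublishedInputs`, Mazur–Wiles Thm. 2,
Cassels–Tate). References: [Cassels1965ArithmeticVIII]; [MilneADT2006] Thm. I.7.3; [SilvermanAEC2009] Thm. X.4.14, VI.4.1(b);
[GreenbergVatsal2000] §3 Rem. 3.4; [SilvermanATAEC1994] Cor. IV.9.2(d); [KrizLi2019] §8; HOME/HANDOFF §line-cfram-p1-w5 g3/g4.
-/

set_option autoImplicit false
-- `…BirchSwinnertonDyer.BirchSwinnertonDyer.Theorems…` is the problem's mandated namespace (D-0017).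
set_option linter.dupNamespace false

noncomputable section

open scoped Classical

namespace Summit.BirchSwinnertonDyer.BirchSwinnertonDyer.Theorems.PrintCFram.HeegnerTwistSha

open WeierstrassCurve WeierstrassCurve.Isogeny WeierstrassCurve.Affine.Point NumberField IsDedekindDomain DirichletCharacter
  Literature.NumberTheory.EllipticCurves
  Literature.NumberTheory.EllipticCurves.ModularForms
  Literature.NumberTheory.EllipticCurves.Rank1Residual
  Literature.NumberTheory.EllipticCurves.KrizLi2019
  Literature.NumberTheory.NumberFields
  Summit.BirchSwinnertonDyer.Rank1Residual
  Summit.BirchSwinnertonDyer.BirchSwinnertonDyer.Theorems.PrintCFram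

/-! ## §1 Cassels + Cassels–Tate + the Néron period relation: `ord_p #Ш` is constant along a rank-zero `p`-isogeny -/

/-- **`ord_p #Ш(W) = ord_p #Ш(W')` ALONG A RATIONAL `p`-ISOGENY IN RANK ZERO.** Let `W ∼ W'` be globally minimal elliptic curves over `ℚ`
with a `ℚ`-isogeny `φ : W → W'` (of degree `p` in the application), `Ш(W/ℚ)` finite, `rank W(ℚ) = 0`, the Néron periods related by `q·Ω(W) = a·Ω(W')`
with `q ∣ p`, `a·b = p` (the output of `exists_int_mul_realPeriodRat_eq_of_isogeny`), and `p ∤ #W(ℚ)_tors`, `p ∤ #W'(ℚ)_tors`,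
`p ∤ ∏c_ℓ(W)`, `p ∤ ∏c_ℓ(W')`. Then `padicValNat p #Ш(W) = padicValNat p #Ш(W')`. Proof: Cassels' invariance of
`#Ш·Reg·Ω·∏c/#tors²` (`hCas`), equality of the regulators in rank `0` (the free-quotient indices multiply to `p^rank = 1`,
`index_mul_index_eq_pow_rank`, `index_mul_regulator_eq_regulator_mul_index`), so `#Ш'·∏c'·t²·(q/a) = #Ш·∏c·t'²`; both orders are
squares (`hCT`), `ord_p(q/a) ∈ {−1,0,1}`, and the side conditions kill `t, t', c, c'`. [cite: MilneADT2006, Ch. I, Thm. 7.3 and its proof (pp. 97–100)]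
[cite: SilvermanAEC2009, Thm. X.4.14 and Thm. VI.4.1(b)] [cite: Cassels1965ArithmeticVIII] -/
theorem padicValNat_shaOrder_eq_of_isogeny_prime_of_rank_zero
    (hCas : bsdRHS_eq_of_isIsogenous) (hCT : exists_casselsTate_pairing (K := ℚ))
    {W W' : WeierstrassCurve ℚ} [W.IsElliptic] [W'.IsElliptic] [W.IsGloballyMinimal] [W'.IsGloballyMinimal]
    {p : ℕ} [hp : Fact p.Prime] (φ : Isogeny W W') (hfin : W.ShaFinite) (hrank : W.mordellWeilRank = 0)
    {q a b : ℤ} (hq0 : q ≠ 0) (hqd : q ∣ (p : ℤ)) (hab : a * b = p)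
    (hΩ : (q : ℝ) * W.realPeriodRat = a * W'.realPeriodRat)
    (ht : ¬ p ∣ W.torsionOrder) (ht' : ¬ p ∣ W'.torsionOrder)
    (hc : ¬ p ∣ W.tamagawaProduct) (hc' : ¬ p ∣ W'.tamagawaProduct) :
    padicValNat p W.shaOrder = padicValNat p W'.shaOrder := by
  -- the group law on `E(ℚ)` with the classical `DecidableEq ℚ` of the general-field theorems
  letI : DecidableEq ℚ := fun a b ↦ Classical.propDecidable (a = b)
  have hpP : p.Prime := hp.out
  -- the dual isogeny and the maps on rational points
  obtain ⟨ψ, hψφ⟩ := φ.exists_dual_of_isElliptic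
  obtain ⟨f, hf⟩ := φ.exists_pointHom
  obtain ⟨g, hg⟩ := ψ.exists_pointHom
  have hgf : ∀ P, g (f P) = φ.degree • P := pointHom_comp_eq_nsmul φ ψ hψφ hf hg
  have hfg : ∀ Q, f (g Q) = φ.degree • Q :=
    pointHom_comp_eq_nsmul ψ φ (comp_eq_zsmul_of_comp_eq_zsmul φ ψ hψφ) hg hf
  have hm : φ.degree ≠ 0 := φ.degree_pos.ne'
  have hfT := comap_torsion_eq_of_comp_eq_nsmul f g hm hgf
  have hgT := comap_torsion_eq_of_comp_eq_nsmul g f hm hfg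
  -- regulators: `i · Reg' = Reg · j`, and `i · j = p ^ rank = 1`, so `Reg' = Reg`
  have hadj := heightPairing_pointHom_left φ ψ hψφ hf hg
  have hC := index_mul_regulator_eq_regulator_mul_index f g hfT hgT hadj
  have hij := index_mul_index_eq_pow_rank φ ψ hψφ hf hg hfT hgT
  rw [hrank, pow_zero] at hij
  set i := (QuotientAddGroup.map _ _ f hfT.ge).range.index with hi
  set j := (QuotientAddGroup.map _ _ g hgT.ge).range.index with hj
  have hi1 : i = 1 := Nat.eq_one_of_mul_eq_one_right hij
  have hj1 : j = 1 := Nat.eq_one_of_mul_eq_one_left hij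
  rw [hi1, hj1, Nat.cast_one, one_mul, mul_one] at hC
  -- Cassels: equal BSD quotients; Cassels–Tate: `#Ш` squares
  obtain ⟨hfin', hRHS⟩ := hCas W W' ⟨φ⟩ hfin
  obtain ⟨s, hs⟩ := isSquare_shaOrder_of_casselsTate hCT W hfin
  obtain ⟨s', hs'⟩ := isSquare_shaOrder_of_casselsTate hCT W' hfin'
  -- positivity of the invariants
  have hSha : 0 < W.shaOrder := shaOrder_pos W hfin
  have hSha' : 0 < W'.shaOrder := shaOrder_pos W' hfin'
  have hT : 0 < W.torsionOrder := torsionOrder_pos_holds W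
  have hT' : 0 < W'.torsionOrder := torsionOrder_pos_holds W'
  have hcp : 0 < W.tamagawaProduct := tamagawaProduct_pos_holds W
  have hcp' : 0 < W'.tamagawaProduct := tamagawaProduct_pos_holds W'
  have hR : 0 < W.regulator := regulator_pos' W
  have hΩpos : 0 < W.realPeriodRat := by
    rw [WeierstrassCurve.realPeriodRat_def]; exact realPeriod_pos' _
  -- `a ≠ 0` and the period ratio `u = q / a`: `Ω(W') = u · Ω(W)`
  have hp0 : (p : ℤ) ≠ 0 := by exact_mod_cast hpP.ne_zero
  have ha0 : a ≠ 0 := by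
    rintro rfl
    exact hp0 (by rw [← hab, zero_mul])
  set u : ℚ := (q : ℚ) / a with hu
  have hu0 : u ≠ 0 := div_ne_zero (by exact_mod_cast hq0) (by exact_mod_cast ha0)
  have hΩ' : W'.realPeriodRat = (u : ℝ) * W.realPeriodRat := by
    have ha0R : (a : ℝ) ≠ 0 := by exact_mod_cast ha0
    rw [hu, Rat.cast_div, Rat.cast_intCast, Rat.cast_intCast]
    field_simp
    linarith [hΩ]
  -- the identity of rational numbers `#Ш'·c'·t²·u = #Ш·c·t'²`
  have E1 : (W'.shaOrder : ℝ) * W'.regulator * W'.realPeriodRat * W'.tamagawaProduct *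
      (W.torsionOrder : ℝ) ^ 2 =
      (W.shaOrder : ℝ) * W.regulator * W.realPeriodRat * W.tamagawaProduct *
      (W'.torsionOrder : ℝ) ^ 2 := by
    have h := hRHS
    rw [bsdRHS_def, bsdRHS_def, div_eq_div_iff (pow_ne_zero _ (by exact_mod_cast hT'.ne'))
      (pow_ne_zero _ (by exact_mod_cast hT.ne'))] at h
    linarith [h]
  have E3 : (W'.shaOrder : ℝ) * W'.tamagawaProduct * (W.torsionOrder : ℝ) ^ 2 * u =
      (W.shaOrder : ℝ) * W.tamagawaProduct * (W'.torsionOrder : ℝ) ^ 2 := by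
    rw [hΩ', hC] at E1
    have hRΩ : W.regulator * W.realPeriodRat ≠ 0 := mul_ne_zero hR.ne' hΩpos.ne'
    have E2 : W.regulator * W.realPeriodRat *
        ((W'.shaOrder : ℝ) * W'.tamagawaProduct * (W.torsionOrder : ℝ) ^ 2 * u -
          (W.shaOrder : ℝ) * W.tamagawaProduct * (W'.torsionOrder : ℝ) ^ 2) = 0 := by
      linear_combination E1
    have := (mul_eq_zero.mp E2).resolve_left hRΩ
    linarith
  have E4 : ((W'.shaOrder * W'.tamagawaProduct * W.torsionOrder ^ 2 : ℕ) : ℚ) * u =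
      ((W.shaOrder * W.tamagawaProduct * W'.torsionOrder ^ 2 : ℕ) : ℚ) := by
    have h : (((W'.shaOrder * W'.tamagawaProduct * W.torsionOrder ^ 2 : ℕ) : ℚ) * u : ℚ) =
        (((W.shaOrder * W.tamagawaProduct * W'.torsionOrder ^ 2 : ℕ) : ℚ) : ℝ) := by
      push_cast
      exact E3
    exact_mod_cast h
  -- `p`-adic valuations: `v(u) = v(q) − v(a) ∈ {−1, 0, 1}`
  have hvq : padicValInt p q ≤ 1 := by
    have hd : q.natAbs ∣ p := by
      have := Int.natAbs_dvd_natAbs.mpr hqd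
      simpa using this
    rcases (Nat.dvd_prime hpP).mp hd with h1 | h1
    · simp [padicValInt, h1]
    · simp [padicValInt, h1]
  have hva : padicValInt p a ≤ 1 := by
    have hd : a.natAbs ∣ p := by
      have := Int.natAbs_dvd_natAbs.mpr (Dvd.intro b hab)
      simpa using this
    rcases (Nat.dvd_prime hpP).mp hd with h1 | h1
    · simp [padicValInt, h1]
    · simp [padicValInt, h1]
  have hvu : padicValRat p u = (padicValInt p q : ℤ) - (padicValInt p a : ℤ) := by
    rw [hu, padicValRat.div (by exact_mod_cast hq0) (by exact_mod_cast ha0), padicValRat.of_int, padicValRat.of_int]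
  have key : (padicValNat p (W'.shaOrder * W'.tamagawaProduct * W.torsionOrder ^ 2) : ℤ) +
      ((padicValInt p q : ℤ) - (padicValInt p a : ℤ)) =
      (padicValNat p (W.shaOrder * W.tamagawaProduct * W'.torsionOrder ^ 2) : ℤ) := by
    have hL := congrArg (padicValRat p) E4
    rw [padicValRat.mul (by positivity) hu0, padicValRat.of_nat, padicValRat.of_nat, hvu] at hL
    exact hL
  -- expand both sides
  have hsq : s ≠ 0 := fun h ↦ by rw [h, mul_zero] at hs; omega
  have hsq' : s' ≠ 0 := fun h ↦ by rw [h, mul_zero] at hs'; omega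
  have hvc : padicValNat p W.tamagawaProduct = 0 := padicValNat.eq_zero_of_not_dvd hc
  have hvc' : padicValNat p W'.tamagawaProduct = 0 := padicValNat.eq_zero_of_not_dvd hc'
  have hvt : padicValNat p W.torsionOrder = 0 := padicValNat.eq_zero_of_not_dvd ht
  have hvt' : padicValNat p W'.torsionOrder = 0 := padicValNat.eq_zero_of_not_dvd ht'
  have hN₁ : padicValNat p (W'.shaOrder * W'.tamagawaProduct * W.torsionOrder ^ 2) = padicValNat p W'.shaOrder := by
    rw [padicValNat.mul (by positivity) (by positivity), padicValNat.mul (by positivity) (by positivity), padicValNat.pow,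
      hvc', hvt]
    omega
  have hN₂ : padicValNat p (W.shaOrder * W.tamagawaProduct * W'.torsionOrder ^ 2) = padicValNat p W.shaOrder := by
    rw [padicValNat.mul (by positivity) (by positivity), padicValNat.mul (by positivity) (by positivity), padicValNat.pow,
      hvc, hvt']
    omega
  have hS : padicValNat p W.shaOrder = 2 * padicValNat p s := by rw [hs, padicValNat.mul hsq hsq]; ring
  have hS' : padicValNat p W'.shaOrder = 2 * padicValNat p s' := by rw [hs', padicValNat.mul hsq' hsq']; ring
  rw [hN₁, hN₂] at key
  omega

/-! ## §2 The side conditions on the CM-ramified class; the partner inherits `Ш[p] = 0` -/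

/-- **`p ∤ #W(ℚ)_tors` on the class**: `W(ℚ_p)[p] = 0` (`prime_nsmul_eq_zero_padic_of_hasCM_of_cmRamified`) and `W(ℚ) ↪ W(ℚ_p)`.
[cite: SilvermanAEC2009, VII.3 Prop. 3.1 and X.5 Cor. 5.4] -/
theorem not_dvd_torsionOrder_of_cmRamified (W : WeierstrassCurve ℚ) [W.IsElliptic] [W.IsGloballyMinimal]
    (p : ℕ) [Fact p.Prime] (hCM : W.HasCM) (hram : CMRamified W p) (h5 : 5 ≤ p) : ¬ p ∣ W.torsionOrder := by
  intro hd
  obtain ⟨T, hT⟩ := exists_addOrderOf_eq_of_dvd_torsionOrder W p hd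
  have hpT : p • T = 0 := by rw [← hT]; exact addOrderOf_nsmul_eq_zero T
  have h0 : W.toPadicPoint p T = 0 :=
    RamifiedSevenEllipticUnits.prime_nsmul_eq_zero_padic_of_hasCM_of_cmRamified W p hCM h5 hram (W.toPadicPoint p T)
      (by rw [← map_nsmul, hpT, _root_.map_zero])
  have hT0 : T = 0 :=
    WeierstrassCurve.Affine.Point.map_injective (Algebra.ofId ℚ ℚ_[p]) (h0.trans (_root_.map_zero (W.toPadicPoint p)).symm)
  rw [hT0, addOrderOf_zero] at hT
  exact (Fact.out : p.Prime).one_lt.ne' hT.symm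

/-- **THE PARTNER INHERITS `Ш[p] = 0`.** Let `V/ℚ` be a globally minimal CM curve, `p ≥ 5` CM-ramified, with `L(V,1) ≠ 0` (so
`rank V(ℚ) = 0` and `Ш(V)` finite, GZK) and `Ш(V/ℚ)[p] = 0`; let `V₁` be a globally minimal CM curve, CM-ramified at `p`, with a
`p`-isogeny `V → V₁`. Then `Ш(V₁/ℚ)[p] = 0`. Granting `ToricPublishedInputs` (GZK, Cassels' `bsdRHS_eq_of_isIsogenous`, the modular
parametrisations feeding `exists_int_mul_realPeriodRat_eq_of_isogeny`) and the Cassels–Tate pairing: §1 gives `ord_p #Ш(V) = ord_p #Ш(V₁)`,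
and for a finite group «no element of order `p`» ⟺ «`p ∤` order» (Cauchy). [cite: MilneADT2006, Ch. I, Thm. 7.3]
[cite: SilvermanAEC2009, Thm. X.4.14] [cite: GreenbergVatsal2000, §3, Remark 3.4] -/
theorem sha_noPTorsion_partner_of_cmRamified
    (hF : Summit.BirchSwinnertonDyer.BirchSwinnertonDyer.Theses.UniversalToricDescent.ToricPublishedInputs)
    (hCT : exists_casselsTate_pairing (K := ℚ))
    (V : WeierstrassCurve ℚ) [V.IsElliptic] [V.IsGloballyMinimal] (p : ℕ) [Fact p.Prime]
    (hCM : V.HasCM) (hram : CMRamified V p) (h5 : 5 ≤ p) (hL : V.entireLFunction 1 ≠ 0)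
    (hsha : ∀ c ∈ V.sha, p • c = 0 → c = 0)
    (V₁ : WeierstrassCurve ℚ) [V₁.IsElliptic] [V₁.IsGloballyMinimal] (hCM₁ : V₁.HasCM) (hram₁ : CMRamified V₁ p)
    (hφ : ∃ φ : Isogeny V V₁, φ.degree = p) :
    ∀ c ∈ V₁.sha, p • c = 0 → c = 0 := by
  have hpP : p.Prime := Fact.out
  obtain ⟨-, -, hGZK, -, hmod, hCas, -⟩ := id hF
  obtain ⟨φ, hdeg⟩ := hφ
  -- rank `0` and finiteness of `Ш(V)` (GZK)
  have hr : V.analyticRank = 0 := analyticRank_eq_zero_of_entireLFunction_one_ne_zero V hL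
  obtain ⟨hrank, hfinSha⟩ := hGZK V (by rw [hr]; exact zero_le_one)
  rw [hr] at hrank
  have hfin : V.ShaFinite := hfinSha
  -- the Néron period relation from the modular parametrisations
  haveI : NeZero (V.conductorNorm ℤ) := ⟨V.conductorNorm_pos_holds.ne'⟩
  haveI : NeZero (V₁.conductorNorm ℤ) := ⟨V₁.conductorNorm_pos_holds.ne'⟩
  obtain ⟨D⟩ := hmod V
  obtain ⟨D₁⟩ := hmod V₁
  obtain ⟨q, a, b, hq0, hqd, hab, hΩ⟩ := SkinnerUrban2014.exists_int_mul_realPeriodRat_eq_of_isogeny D D₁ φ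
  rw [hdeg] at hqd hab
  -- §1
  have hv := padicValNat_shaOrder_eq_of_isogeny_prime_of_rank_zero hCas hCT φ hfin hrank hq0 hqd hab hΩ
    (not_dvd_torsionOrder_of_cmRamified V p hCM hram h5) (not_dvd_torsionOrder_of_cmRamified V₁ p hCM₁ hram₁ h5)
    (X12.O11.RouteU.not_dvd_tamagawaProduct_of_hasCM V hCM p hpP h5)
    (X12.O11.RouteU.not_dvd_tamagawaProduct_of_hasCM V₁ hCM₁ p hpP h5)
  -- `p ∤ #Ш(V)` from `Ш(V)[p] = 0`, hence `p ∤ #Ш(V₁)`, hence `Ш(V₁)[p] = 0`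
  haveI : Finite V.sha := hfin
  have hfin₁ : V₁.ShaFinite := (hCas V V₁ ⟨φ⟩ hfin).1
  haveI : Finite V₁.sha := hfin₁
  have hnd : ¬ p ∣ V.shaOrder := by
    intro hd
    obtain ⟨x, hx⟩ := exists_prime_addOrderOf_dvd_card' (G := V.sha) p (by rwa [shaOrder] at hd)
    have hx0 : (x : V.galH1) = 0 := hsha x x.2 (by
      rw [← AddSubgroupClass.coe_nsmul, ← hx, addOrderOf_nsmul_eq_zero, ZeroMemClass.coe_zero])
    have : addOrderOf x = 1 := by rw [AddMonoid.addOrderOf_eq_one_iff]; exact Subtype.ext hx0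
    rw [this] at hx
    exact hpP.one_lt.ne' hx.symm
  have hnd₁ : ¬ p ∣ V₁.shaOrder := by
    intro hd
    apply hnd
    have h1 : 1 ≤ padicValNat p V₁.shaOrder :=
      (padicValNat_dvd_iff_le (n := 1) (shaOrder_pos V₁ hfin₁).ne').mp (by rwa [pow_one])
    rw [← hv] at h1
    have h2 := (padicValNat_dvd_iff_le (n := 1) (shaOrder_pos V hfin).ne').mpr h1
    rwa [pow_one] at h2
  intro c hc hpc
  by_contra hc0
  set c' : V₁.sha := ⟨c, hc⟩ with hc'
  have hc'0 : c' ≠ 0 := fun h ↦ hc0 (congrArg Subtype.val h)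
  have hpc' : p • c' = 0 := Subtype.ext hpc
  have hord : addOrderOf c' = p := addOrderOf_eq_prime hpc' hc'0
  exact hnd₁ (by rw [shaOrder, ← hord]; exact addOrderOf_dvd_natCard c')

/-! ## §3 Stub C from ONE Ш[p]-trivial admissible Heegner twist -/

/-- **UNIT FIELD FACTOR FROM ONE `Ш[p]`-TRIVIAL TWIST** — `not_fieldFactor_le_of_twist_noPTorsion_pair` WITHOUT the partner clause:
class member `W` (CM, `CMRamified W p`, `p ≥ 5`), odd datum + `hss`, `K` imaginary quadratic with Kronecker `ε_K`, a globally minimal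
`C • W.quadraticTwist d_K = Wd` with `L(W^{(d_K)},1) ≠ 0` and `Ш(Wd)[p] = 0` ⊢ `¬ ‖B_{1,(ψε_Kω⁻¹)~}‖ ≤ p⁻¹`. The partner clause is
§2's `sha_noPTorsion_partner_of_cmRamified`. CONDITIONAL on `hMW`, `hF` (`ToricPublishedInputs`), `hCT`; closes no stub.
[cite: MazurWiles1984, Thm. 2 (p. 216)] [cite: MilneADT2006, Ch. I, Thm. 7.3] [cite: KrizLi2019, Thm. 1.20 (p. 8) and §7.1 (p. 43)] -/
theorem not_fieldFactor_le_of_twist_noPTorsion {p : ℕ} [Fact p.Prime]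
    (hMW : MazurWiles1984.thm2_card_oddChiClassGroup_eq_bernoulli)
    (hF : Summit.BirchSwinnertonDyer.BirchSwinnertonDyer.Theses.UniversalToricDescent.ToricPublishedInputs)
    (hCT : exists_casselsTate_pairing (K := ℚ))
    (W : WeierstrassCurve ℚ) [W.IsElliptic] (hCM : W.HasCM) (hram : CMRamified W p) (h5 : 5 ≤ p)
    {f : ℕ} [NeZero f] (ψ : DirichletCharacter ℚ_[p] f) (ω : DirichletCharacter ℚ_[p] p)
    (hψ : ψ.Odd) (hω : IsTeichmullerCharacter ω)
    (hss : ∀ ℓ : ℕ, ℓ.Prime → ¬ (ℓ ∣ p * W.conductorNorm ℤ) →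
      ‖((W.LFunction ℓ : ℤ) : ℚ_[p]) - (ψ (ℓ : ZMod f) + ψ⁻¹ (ℓ : ZMod f) * ω (ℓ : ZMod p))‖ < 1)
    (K : Type) [Field K] [NumberField K] (hK : IsImaginaryQuadratic K)
    (εK : DirichletCharacter ℚ_[p] (NumberField.discr K).natAbs) (hεK : IsKroneckerCharacterOf K εK)
    (Wd : WeierstrassCurve ℚ) [Wd.IsElliptic] [Wd.IsGloballyMinimal]
    (hC : ∃ C : VariableChange ℚ, C • W.quadraticTwist (NumberField.discr K : ℚ) = Wd)
    (hLt : (W.quadraticTwist (NumberField.discr K : ℚ)).entireLFunction 1 ≠ 0)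
    (hsha : ∀ c ∈ Wd.sha, p • c = 0 → c = 0) :
    ¬ ‖bernoulliOnePrim (bernoulliCharTwo ψ εK ω)‖ ≤ (p : ℝ)⁻¹ := by
  obtain ⟨-, -, hGZK, -⟩ := id hF
  have hD0 : (NumberField.discr K : ℚ) ≠ 0 := by exact_mod_cast NumberField.discr_ne_zero K
  obtain ⟨hCMd, hramd⟩ := ParitySplit.hasCM_and_cmRamified_of_smul_quadraticTwist W hCM hram hD0 Wd hC
  have hLd : Wd.entireLFunction 1 ≠ 0 := by
    obtain ⟨C, rfl⟩ := hC
    haveI : (W.quadraticTwist (NumberField.discr K : ℚ)).IsElliptic := W.isElliptic_quadraticTwist hD0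
    rw [entireLFunction_smul]; exact hLt
  exact not_fieldFactor_le_of_twist_noPTorsion_pair hMW hGZK W hCM hram h5 ψ ω hψ hω hss K hK εK hεK Wd hC hLt hsha
    fun W₁ _ _ hCM₁ hram₁ hφ ↦ sha_noPTorsion_partner_of_cmRamified hF hCT Wd p hCMd hramd h5 hLd hsha W₁ hCM₁ hram₁ hφ

/-- **STUB C ⟸ C_Ш¹ (ONE CURVE, ONE CONDITION).** Registry v19's Stub C `stub_heegnerField_of_unitClassFactor` — VERBATIM — follows from
**C_Ш¹** := «for every globally minimal CM curve `W/ℚ`, `p ≥ 5` CM-ramified, `r_an(W) = 1`, there are an imaginary quadratic `K`, Heegner for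
`N_W`, `d_K` odd `< −4`, with `L(W^{(d_K)},1) ≠ 0`, and a globally minimal model `Wd` of `W^{(d_K)}` with `Ш(Wd/ℚ)[p] = 0`» — the
partner clause of C_Ш (p680012) being automatic by §2. CONDITIONAL on `hMW`, `hF` (`ToricPublishedInputs`), `hCT`; closes no stub; BSD is
not proved by any of this. [cite: MazurWiles1984, Thm. 2 (p. 216)] [cite: KrizLi2019, Thm. 1.20 (p. 8) and §8] [cite: MilneADT2006, Ch. I, Thm. 7.3] -/
theorem stubC_of_heegnerTwistShaSupply_single
    (hMW : MazurWiles1984.thm2_card_oddChiClassGroup_eq_bernoulli)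
    (hF : Summit.BirchSwinnertonDyer.BirchSwinnertonDyer.Theses.UniversalToricDescent.ToricPublishedInputs)
    (hCT : exists_casselsTate_pairing (K := ℚ))
    (hSupply : ∀ (W : WeierstrassCurve ℚ) [W.IsElliptic] [W.IsGloballyMinimal] (p : ℕ) [Fact p.Prime],
      W.HasCM → CMRamified W p → 5 ≤ p → W.analyticRank = 1 →
      ∃ (K : Type) (_ : Field K) (_ : NumberField K), IsImaginaryQuadratic K ∧
        SatisfiesHeegnerHypothesis (W.conductorNorm ℤ) K ∧ Odd (NumberField.discr K) ∧ NumberField.discr K < -4 ∧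
        (W.quadraticTwist (NumberField.discr K : ℚ)).entireLFunction 1 ≠ 0 ∧
        ∃ (Wd : WeierstrassCurve ℚ) (_ : Wd.IsElliptic) (_ : Wd.IsGloballyMinimal),
          (∃ C : VariableChange ℚ, C • W.quadraticTwist (NumberField.discr K : ℚ) = Wd) ∧
          ∀ c ∈ Wd.sha, p • c = 0 → c = 0) :
    ∀ (W : WeierstrassCurve ℚ) [W.IsElliptic] [W.IsGloballyMinimal] (p : ℕ) [Fact p.Prime], W.HasCM → CMRamified W p → 5 ≤ p →
      W.analyticRank = 1 → ∀ (f : ℕ) [NeZero f] (ψ : DirichletCharacter ℚ_[p] f) (ω : DirichletCharacter ℚ_[p] p), ψ.Odd →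
      IsTeichmullerCharacter ω →
      (∀ ℓ : ℕ, ℓ.Prime → ¬ (ℓ ∣ p * W.conductorNorm ℤ) →
        ‖((W.LFunction ℓ : ℤ) : ℚ_[p]) - (ψ (ℓ : ZMod f) + ψ⁻¹ (ℓ : ZMod f) * ω (ℓ : ZMod p))‖ < 1) →
      ¬ ‖bernoulliOnePrim ψ⁻¹‖ ≤ (p : ℝ)⁻¹ →
      ∃ (K : Type) (_ : Field K) (_ : NumberField K) (εK : DirichletCharacter ℚ_[p] (NumberField.discr K).natAbs),
        IsImaginaryQuadratic K ∧ SatisfiesHeegnerHypothesis (W.conductorNorm ℤ) K ∧ Odd (NumberField.discr K) ∧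
        NumberField.discr K < -4 ∧ IsKroneckerCharacterOf K εK ∧
        ¬ ‖bernoulliOnePrim (bernoulliCharTwo ψ εK ω)‖ ≤ (p : ℝ)⁻¹ := by
  intro W _ _ p _ hCM hram h5 hr f _ ψ ω hψ hω hss _hcls
  obtain ⟨K, iK, iK', hK, hH, hodd, hd4, hLt, Wd, iWd, iWd', hC, hsha⟩ := hSupply W p hCM hram h5 hr
  obtain ⟨εK, hεK⟩ := OffLocusDictionary.exists_isKroneckerCharacterOf (p := p) hK.1
  exact ⟨K, iK, iK', εK, hK, hH, hodd, hd4, hεK,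
    not_fieldFactor_le_of_twist_noPTorsion hMW hF hCT W hCM hram h5 ψ ω hψ hω hss K hK εK hεK Wd hC hLt hsha⟩

end Summit.BirchSwinnertonDyer.BirchSwinnertonDyer.Theorems.PrintCFram.HeegnerTwistSha

end
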